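import Literature.Analysis.InnerProduct.SubspaceLeakage
import Literature.Analysis.InnerProduct.NearNullLeakage
import Literature.Analysis.InnerProduct.InvariantDichotomy
import HarnessLib

/-!
# PF-persistence THEORY 3 — "the intruder mode past a* is orthogonal to the transported prolate span",
# typed and decided (publication cell `pub-rhpf`, theory seat 3)

Framing (page 1 of every `pub-rhpf` file): **mechanism/rigidity campaign — nothing here is a claim
about RH.**  Everything in this file is PROVED abstract linear algebra or a DEFINITION; no statement
about `ζ` or about any control family is made; every empirical sentence in the docstrings is labelled
DATA and refers to the observatory records (`run/shared/lean/pub/pub-rhpf/pub-rhpf-theory-3/THEORY-INTRUDER.md`).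

Setting (ONE window): `E` a real inner product space (the even cosine sector `E_N(a)` of the windowed
form at cutoff `λ = e^a`, truncation `N`), `T : E →ₗ[ℝ] E` symmetric (the form's Galerkin matrix),
`V : Submodule ℝ E` a FIXED trial span (the archimedean transported prolate span `V_K(a,N)` of the
observatory, ATLAS B10), and `W : Submodule ℝ E` a `T`-INVARIANT subspace.  Per RULING A24 (k3):
`W :=` the spectral subspace of the SAME-window operator `T = T_{a'}` onto which the pre-a* bottom cluster
is continued — invariance is then BY CONSTRUCTION (a spectral subspace of a symmetric operator is
invariant with invariant orthogonal complement; the Kato transformation function maps the spectral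
subspace at `a` onto the spectral subspace at `a'`, Kato 1966 II-§4.2 (4.7)–(4.9), II-§6.2 [CITED]) — and
NOT "the numerically continued basis", whose invariance would be DATA.

* `Intruder T`                — D3 (I-min): a unit eigenvector of `T` with negative eigenvalue.
* `SameWindowOrthogonal T`    — reading (R-a): intruder ⟂ every same-window eigenvector with another
  eigenvalue.  THEOREM for symmetric `T` (`sameWindowOrthogonal_of_isSymmetric`, from the tree lemma
  `Literature.Analysis.InnerProduct.inner_eq_zero_of_eigenvector_ne`).  Instance hypotheses: `T.IsSymmetric`
  — by construction; "`ν ≠ I.eig`" (the demoted nodeless state is not degenerate with the intruder) — DATA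
  per window.
* `InvariantDichotomy T W`    — reading (R-b): an intruder with SIMPLE eigenvalue lies in `W` or in `Wᗮ`.
  THEOREM (`invariantDichotomy_of_isSymmetric`, from the tree lemma
  `Literature.Analysis.InnerProduct.mem_or_mem_orthogonal_of_eigenvector`): exactly true or exactly false,
  decided by an integer (whether the intruder's branch belongs to the continued cluster), never a tolerance
  statement.  Instance hypotheses: `W` invariant — by construction (above); simplicity of the intruder
  eigenvalue — DATA per window (ladder-index census, gap-class rows S3-I1 / PF-I3).
  `capture_eq_one_or_eq_zero`: the capture `‖P_W u‖` of a unit intruder is exactly `1` or exactly `0`.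
* `capture_mul_le_div`        — (R-b) QUANTITATIVE (tree lemma `…norm_starProjection_mul_norm_sub_le_div`,
  the `sin 2θ` shape of Davis–Kahan): for ANY subspace `W`, `‖P_W u‖·‖u − P_W u‖ ≤ η/γ` with `η` the
  reducing defect `‖T(P_W u) − ε P_W u‖` and `γ` the gap of `ε` on `uᗮ`; so an APPROXIMATELY transported
  span (defect `η`, e.g. a numerically continued frame) captures a gapped intruder up to `½ sin 2θ ≤ η/γ`.
  Honest bite (DATA): the bottom-cluster gaps of the served windows are `10⁻¹⁷…10⁻²²`, so this certifies
  only defects below that size.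
* `CaptureAtMost T V δ`       — reading (R-c): ‖P_V u‖ ≤ δ for every intruder; `captureAtMost_of_small_on`
  (tree lemma `…norm_starProjection_le_of_eigenvector`): δ = ρ/m is FORCED whenever ‖T v‖ ≤ ρ‖v‖ on `V` and
  |ε| ≥ m — near-null leakage; DATA (THEORY-INTRUDER §8): on the served windows ρ_K/|ε₁| ≥ 10⁵, i.e. this
  bound is vacuous there and (R-c)-type near-orthogonality carries only |ε₁|-size information.
* `NoIntruderOutsideSpan T V` — the payload's candidate functional, typed; DATA (kit job j053409,
  THEORY-INTRUDER §3): FALSE for the Davenport–Heilbronn control at a = 1.72 (capture 1 − 10⁻⁴·⁴) and for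
  dip / swap-in-span control windows — not an invariant of any family (gap-class row TH3-I1; harness verdict
  `theory3-no-swap-L2-v1`: fails-controls).

Don't-look sentence (RULING A24 k4): intruder ⟂ same-window eigenvectors holds identically for every
symmetric control; intruder ∈ W or ∈ W⊥ exactly, decided by the ladder index — hence neither reading
separates ζ from any symmetric control (DH, Epstein, Cramér, Beurling, planted, λ-pert are all symmetric).

## References
* T. Kato, *Perturbation Theory for Linear Operators* (1966), I-§3.5, II-§4.2 (4.7)–(4.9), II-§6.2,
  V-§3.9 (3.34). [Kato1966]
* C. Davis, W. M. Kahan, SIAM J. Numer. Anal. 7 (1970) 1–46 (sin 2Θ theorem). [DavisKahan1970]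
* G. H. Golub, C. F. Van Loan, *Matrix Computations*, 4th ed. (2013), §8.1.3. [GolubVanLoan2013]
-/

noncomputable section

open scoped InnerProductSpace

namespace Summit.RiemannHypothesis.RiemannHypothesis.Theorems.PfPersistenceIntruderOrthogonality

open Literature.Analysis.InnerProduct

variable {E : Type*} [NormedAddCommGroup E] [InnerProductSpace ℝ E]

/-- D3 (I-min, one window): an *intruder* of the operator `T` is a unit eigenvector with negative
eigenvalue. [folklore] -/
structure Intruder (T : E →ₗ[ℝ] E) where
  /-- the eigenvector -/
  vec : E
  /-- its eigenvalue -/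
  eig : ℝ
  eig_neg : eig < 0
  norm_eq : ‖vec‖ = 1
  apply_eq : T vec = eig • vec

/-- Reading (R-a): every intruder is orthogonal to every eigenvector of the same window belonging to a
different eigenvalue (in particular to the demoted nodeless state). [folklore] -/
def SameWindowOrthogonal (T : E →ₗ[ℝ] E) : Prop :=
  ∀ I : Intruder T, ∀ (v : E) (ν : ℝ), T v = ν • v → ν ≠ I.eig → ⟪I.vec, v⟫_ℝ = 0

/-- (R-a) is a theorem of linear algebra for every symmetric `T` — structural, not arithmetic
(tree lemma `inner_eq_zero_of_eigenvector_ne`). [folklore] -/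
theorem sameWindowOrthogonal_of_isSymmetric {T : E →ₗ[ℝ] E} (hT : T.IsSymmetric) :
    SameWindowOrthogonal T := by
  intro I v ν hv hne
  exact inner_eq_zero_of_eigenvector_ne (𝕜 := ℝ) hT (μ := I.eig) (ν := ν)
    (by simpa using I.apply_eq) (by simpa using hv) hne.symm

/-- Reading (R-b): for a subspace `W` (the same-window spectral subspace continuing the pre-a* cluster,
RULING A24 k3 (i)), every intruder whose eigenvalue is simple lies inside `W` or inside `Wᗮ`. [folklore] -/
def InvariantDichotomy (T : E →ₗ[ℝ] E) (W : Submodule ℝ E) : Prop :=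
  ∀ I : Intruder T, (∀ v : E, T v = I.eig • v → ∃ c : ℝ, v = c • I.vec) → I.vec ∈ W ∨ I.vec ∈ Wᗮ

/-- (R-b) is a theorem for every REDUCING pair (`W` and `Wᗮ` both `T`-invariant; no symmetry needed)
(tree lemma `mem_or_mem_orthogonal_of_eigenvector`). [folklore] -/
theorem invariantDichotomy_of_invariant {T : E →ₗ[ℝ] E} (W : Submodule ℝ E) [W.HasOrthogonalProjection]
    (hW : ∀ w ∈ W, T w ∈ W) (hW' : ∀ w ∈ Wᗮ, T w ∈ Wᗮ) : InvariantDichotomy T W :=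
  fun I hsimple ↦ mem_or_mem_orthogonal_of_eigenvector W hW hW' I.apply_eq hsimple

/-- (R-b) for a symmetric `T` and a `T`-invariant `W` (then `Wᗮ` is invariant automatically, tree lemma
`apply_mem_orthogonal_of_isSymmetric`): "intruder ⟂ transported span" is exactly true or exactly false,
decided by the branch bookkeeping, never a tolerance statement — structural, not arithmetic. [folklore] -/
theorem invariantDichotomy_of_isSymmetric {T : E →ₗ[ℝ] E} (hT : T.IsSymmetric) (W : Submodule ℝ E)
    [W.HasOrthogonalProjection] (hW : ∀ w ∈ W, T w ∈ W) : InvariantDichotomy T W :=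
  invariantDichotomy_of_invariant W hW (fun _ hx ↦ apply_mem_orthogonal_of_isSymmetric hT W hW hx)

/-- (R-b), capture form: for symmetric `T`, invariant `W` and an intruder with simple eigenvalue, the
capture `‖P_W u‖` is exactly `1` or exactly `0`. [folklore] -/
theorem capture_eq_one_or_eq_zero {T : E →ₗ[ℝ] E} (hT : T.IsSymmetric) (W : Submodule ℝ E)
    [W.HasOrthogonalProjection] (hW : ∀ w ∈ W, T w ∈ W) (I : Intruder T)
    (hsimple : ∀ v : E, T v = I.eig • v → ∃ c : ℝ, v = c • I.vec) :
    ‖W.starProjection I.vec‖ = 1 ∨ ‖W.starProjection I.vec‖ = 0 := by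
  rcases starProjection_eq_self_or_eq_zero_of_eigenvector W hW
      (fun _ hx ↦ apply_mem_orthogonal_of_isSymmetric hT W hW hx) I.apply_eq hsimple with h | h
  · exact Or.inl (by rw [h, I.norm_eq])
  · exact Or.inr (by rw [h, norm_zero])

/-- (R-b) QUANTITATIVE (`sin 2θ`): for ANY subspace `W` and an intruder whose eigenvalue has gap `γ > 0`
on `uᗮ`, the capture satisfies `‖P_W u‖ · ‖u − P_W u‖ ≤ η / γ`, `η` = the reducing defect
`‖T (P_W u) − ε P_W u‖` (zero when `W, Wᗮ` are invariant).  An approximately transported span captures a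
gapped intruder up to `½ sin 2θ ≤ η/γ` (tree lemma `norm_starProjection_mul_norm_sub_le_div`).
[cite: DavisKahan1970, sin 2Θ theorem] -/
theorem capture_mul_le_div {T : E →ₗ[ℝ] E} (W : Submodule ℝ E) [W.HasOrthogonalProjection]
    (I : Intruder T) {γ η : ℝ} (hγ : 0 < γ)
    (hgap : ∀ x : E, ⟪I.vec, x⟫_ℝ = 0 → γ * ‖x‖ ≤ ‖T x - I.eig • x‖)
    (hη : ‖T (W.starProjection I.vec) - I.eig • W.starProjection I.vec‖ ≤ η) :
    ‖W.starProjection I.vec‖ * ‖I.vec - W.starProjection I.vec‖ ≤ η / γ :=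
  norm_starProjection_mul_norm_sub_le_div W I.apply_eq I.norm_eq hγ hgap hη

/-- Reading (R-c), quantitative form: every intruder has component at most `δ` inside the FIXED subspace
`V` (the archimedean prolate span of the window).  `δ = 0` is literal orthogonality. [folklore] -/
def CaptureAtMost (T : E →ₗ[ℝ] E) (V : Submodule ℝ E) [V.HasOrthogonalProjection] (δ : ℝ) : Prop :=
  ∀ I : Intruder T, ‖V.starProjection I.vec‖ ≤ δ

/-- The payload's candidate functional, typed: "no intruder component outside the transported span",
i.e. every intruder lies INSIDE `V`.  DATA: false for the DH control past a* = 1.72 and for swap-type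
control windows, true for dip-type ones — THEORY-INTRUDER §3; harness `theory3-no-swap-L2-v1`
fails-controls. [folklore] -/
def NoIntruderOutsideSpan (T : E →ₗ[ℝ] E) (V : Submodule ℝ E) : Prop :=
  ∀ I : Intruder T, I.vec ∈ V

/-- Near-null leakage ((R-c) is forced up to |ε|-size): if `T` is `ρ`-small on `V` then every intruder
with `|ε| ≥ m > 0` has capture at most `ρ / m` (tree lemma `norm_starProjection_le_of_eigenvector`).
[cite: GolubVanLoan2013, §8.1.3 Thm 8.1.13] -/
theorem captureAtMost_of_small_on {T : E →ₗ[ℝ] E} (hT : T.IsSymmetric) (V : Submodule ℝ E)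
    [V.HasOrthogonalProjection] {ρ m : ℝ} (hρ : 0 ≤ ρ) (hm : 0 < m)
    (hρV : ∀ v ∈ V, ‖T v‖ ≤ ρ * ‖v‖) (hgap : ∀ I : Intruder T, m ≤ |I.eig|) :
    CaptureAtMost T V (ρ / m) := by
  intro I
  have hε : I.eig ≠ 0 := ne_of_lt I.eig_neg
  have h := norm_starProjection_le_of_eigenvector (𝕜 := ℝ) V hT (u := I.vec) (ε := I.eig)
    (by simpa using I.apply_eq) hε hρ hρV
  rw [I.norm_eq, mul_one, Real.norm_eq_abs] at h
  calc ‖V.starProjection I.vec‖ ≤ ρ / |I.eig| := h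
    _ ≤ ρ / m := div_le_div_of_nonneg_left hρ hm (hgap I)

/-- If the candidate functional held, every intruder would have full capture: `NoIntruderOutsideSpan`
implies `CaptureAtMost` fails for every `δ < 1` as soon as one intruder exists — the typed form of
"(R-c) with δ → 0 and the candidate functional cannot both describe a window with an intruder". [folklore] -/
theorem norm_starProjection_eq_one_of_noIntruderOutsideSpan {T : E →ₗ[ℝ] E} (V : Submodule ℝ E)
    [V.HasOrthogonalProjection] (h : NoIntruderOutsideSpan T V) (I : Intruder T) :
    ‖V.starProjection I.vec‖ = 1 := by
  rw [Submodule.starProjection_eq_self_iff.mpr (h I), I.norm_eq]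

end Summit.RiemannHypothesis.RiemannHypothesis.Theorems.PfPersistenceIntruderOrthogonality

end
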